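import Literature.NumberTheory.Automorphic.UnitaryGroupDoubledSiegelLevi
import HarnessLib

/-!
# Every element of the Siegel parabolic `P_Δ` of the doubled unitary group is a product of squares of elements of `P_Δ`

Topic `NumberTheory/Automorphic`; namespace `Literature.NumberTheory.Automorphic.DoubledUnitary` (sequel of
`UnitaryGroupDoubledSiegelLevi`).  KERNEL only: proved theorems, no definition, no named fact, no `sorry`.

Setting ([Kudla1994, §3]; [HarrisKudlaSweet1996, §1 (1.9)–(1.12)]): `R` a commutative ring with an INVOLUTION `σ` and
`2 ∈ Rˣ`; `S ∈ M_ι(R)` symmetric, `σ`-fixed, of unit determinant; the doubled unitary group `U(σ, S ⊕ −S)` (or any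
re-enumeration `U(σ, reindex e e (S ⊕ −S))`, e.g. `e = finSumFinEquiv`) and its Siegel parabolic
`P_Δ = {p ∣ p₁₁ + p₁₂ = p₂₁ + p₂₂}` (the tree's `DoubledUnitary.IsSiegelReindex e`, verbatim GR-2's `IsSiegelDelta`).

* `exists_list_sq_of_isSiegel_blocks` (block enumeration `ι ⊕ ι`) and
* `exists_list_sq_of_isSiegelReindex` (re-enumerated along `e : ι ⊕ ι ≃ m`, typed on the subgroup `↥U(σ, J)` for any
  spelling `J = reindex e e (S ⊕ −S)`):
  **if `GL_ι(R)` is generated by squares, every `p ∈ P_Δ` is `(l.map (q ↦ q²)).prod` for a list `l` of elements of `P_Δ`.**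

Proof.  In the Cayley basis `C = [[1,1],[1,−1]]` the form is `antidiag(τ, τ)`, `τ = 2S`, and `P_Δ` becomes the block-upper
subgroup; a block-upper `h = [[α, β],[0, δ]]` of `U(σ, antidiag(τ, τ))` has `α ∈ GL_ι(R)`, `δ = τ⁻¹σ(α⁻¹)ᵀτ` (the `(1,2)`
block of the unitarity equation) and factors as `h = m(α) n(α⁻¹β)` with the Levi homomorphism `m` and the unipotent `n` of
`UnitaryGroupDoubledSiegelLevi`; `n(y) = n(y/2)²` (`2 ∈ Rˣ`, the membership criterion of `n` is linear), and
`m(α) = ∏ m(sᵢ)²` when `α = ∏ sᵢ²` in `GL_ι(R)`.  Conjugating back by `C` preserves squares, `U`, and the Siegel condition.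

Use.  With `R = L ⊗ ℝ ≅ ∏_w ℂ` (`GL_n(ℂ)` is generated by squares: `Literature.LinearAlgebra.Matrix.GeneralLinearGroup.
closure_isSquare_eq_top_of_isAlgClosed`) this is input U3 («every element of `P_Δ(L⁺ ⊗ ℝ) ≅ ∏_w GL_n(ℂ) ⋉ Herm_n` is a
product of squares», whence `{±1}`-valued multiplicative functions on `P_Δ` are trivial) of the archimedean half
`stub_S1arch` of the kernel construction of [GelbartRogawski1991, Prop. 3.1.1] (stage-1 cell `pub-hodgecm`, seat GR-3).

## References

* S. S. Kudla, Israel J. Math. 87 (1994), §3 [Kudla1994].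
* M. Harris, S. S. Kudla, W. J. Sweet, J. Amer. Math. Soc. 9 (1996), §1 (1.9)–(1.12) [HarrisKudlaSweet1996].
-/

set_option autoImplicit false

open Matrix

namespace Literature.NumberTheory.Automorphic.DoubledUnitary

variable {R : Type*} [CommRing R] {ι : Type*} [Fintype ι] [DecidableEq ι] (σ : R →+* R)

/-! ### lists of squares -/

/-- In a group generated by its squares every element is a product of squares, as a list. [folklore] -/
private theorem exists_list_sq_of_closure_isSquare_eq_top {G : Type*} [Group G]
    (hG : Subgroup.closure {g : G | IsSquare g} = ⊤) (x : G) :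
    ∃ l : List G, x = (l.map fun q => q * q).prod := by
  have hx : x ∈ Subgroup.closure {g : G | IsSquare g} := hG ▸ Subgroup.mem_top x
  induction hx using Subgroup.closure_induction with
  | mem x hx =>
    obtain ⟨r, rfl⟩ := hx
    exact ⟨[r], by simp⟩
  | one => exact ⟨[], by simp⟩
  | mul x y _ _ ihx ihy =>
    obtain ⟨l₁, rfl⟩ := ihx
    obtain ⟨l₂, rfl⟩ := ihy
    exact ⟨l₁ ++ l₂, by rw [List.map_append, List.prod_append]⟩
  | inv x _ ih =>
    obtain ⟨l, rfl⟩ := ih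
    refine ⟨(l.map fun q => q⁻¹).reverse, ?_⟩
    rw [List.prod_inv_reverse, List.map_map, List.map_reverse, List.map_map]
    exact congrArg (fun l : List G => l.reverse.prod) (List.map_congr_left fun q _ =>
      show (q * q)⁻¹ = q⁻¹ * q⁻¹ from _root_.mul_inv_rev q q)

/-- squares of images: `((l.map f).map sq).prod = f ((l.map sq).prod)`. [folklore] -/
private theorem map_prod_map_sq {G H : Type*} [Monoid G] [Monoid H] (f : G →* H) (l : List G) :
    ((l.map f).map fun q => q * q).prod = f (l.map fun q => q * q).prod := by
  rw [map_list_prod, List.map_map, List.map_map]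
  congr 2
  funext q
  simp only [Function.comp_apply, map_mul]

/-! ### the core theorem in the block enumeration `ι ⊕ ι` -/

/-- **Every element of the Siegel parabolic `P_Δ` of `U(σ, S ⊕ −S)` is a product of squares of elements of `P_Δ`**
(block enumeration), provided `GL_ι(R)` is generated by squares: for `σ` an involution of the commutative ring `R` with
`2 ∈ Rˣ`, `S` symmetric `σ`-fixed with unit determinant, and `g ∈ U(σ, S ⊕ −S)` with `g₁₁ + g₁₂ = g₂₁ + g₂₂`.  Proof: in the
Cayley basis `C = [[1,1],[1,−1]]` the form is `antidiag(τ, τ)`, `τ = 2S`, and `C⁻¹ g C = [[α, β], [0, δ]] = m(α) · n(α⁻¹β)`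
with `m(α) = diag(α, τ⁻¹σ(α⁻¹)ᵀτ)` a homomorphism of `GL_ι(R)` and `n(y) = n(y/2)²`. [cite: HarrisKudlaSweet1996, §1 (1.11)] -/
theorem exists_list_sq_of_isSiegel_blocks (hσ : ∀ x, σ (σ x) = x) (h2 : IsUnit (2 : R))
    {S : Matrix ι ι R} (hSσ : S.map σ = S) (hSs : Sᵀ = S) (hSu : IsUnit S.det)
    (hGL : Subgroup.closure {A : GL ι R | IsSquare A} = ⊤)
    {g : GL (ι ⊕ ι) R} (hgU : g ∈ unitaryGroupOfForm σ (Matrix.fromBlocks S 0 0 (-S)))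
    (hgP : (g : Matrix (ι ⊕ ι) (ι ⊕ ι) R).toBlocks₁₁ + (g : Matrix (ι ⊕ ι) (ι ⊕ ι) R).toBlocks₁₂ =
      (g : Matrix (ι ⊕ ι) (ι ⊕ ι) R).toBlocks₂₁ + (g : Matrix (ι ⊕ ι) (ι ⊕ ι) R).toBlocks₂₂) :
    ∃ l : List (GL (ι ⊕ ι) R),
      (∀ q ∈ l, q ∈ unitaryGroupOfForm σ (Matrix.fromBlocks S 0 0 (-S)) ∧
        (q : Matrix (ι ⊕ ι) (ι ⊕ ι) R).toBlocks₁₁ + (q : Matrix (ι ⊕ ι) (ι ⊕ ι) R).toBlocks₁₂ =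
          (q : Matrix (ι ⊕ ι) (ι ⊕ ι) R).toBlocks₂₁ + (q : Matrix (ι ⊕ ι) (ι ⊕ ι) R).toBlocks₂₂) ∧
      g = (l.map fun q => q * q).prod := by
  classical
  -- `u = 1/2`, fixed by `σ`
  obtain ⟨u, hu⟩ := h2.exists_left_inv
  have hu' : 2 * u = 1 := by rw [mul_comm]; exact hu
  have hσu : σ u = u := by
    have h1 : σ u * 2 = 1 := by
      have := congrArg σ hu
      rwa [map_mul, map_ofNat, map_one] at this
    calc σ u = σ u * (2 * u) := by rw [hu', mul_one]
      _ = u := by rw [← mul_assoc, h1, one_mul]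
  -- the Cayley unit
  set C : Matrix (ι ⊕ ι) (ι ⊕ ι) R :=
    Matrix.fromBlocks (1 : Matrix ι ι R) (1 : Matrix ι ι R) (1 : Matrix ι ι R) (-1 : Matrix ι ι R) with hC
  have hCC : C * C = (2 : R) • (1 : Matrix (ι ⊕ ι) (ι ⊕ ι) R) := cayleyMat_mul_self
  have hCu1 : C * (u • C) = 1 := by rw [Matrix.mul_smul, hCC, smul_smul, hu, one_smul]
  have hCu2 : u • C * C = 1 := by rw [Matrix.smul_mul, hCC, smul_smul, hu, one_smul]
  set Cu : GL (ι ⊕ ι) R := ⟨C, u • C, hCu1, hCu2⟩ with hCudef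
  -- `τ = 2S` and the antidiagonal form
  set τ : Matrix ι ι R := S + S with hτ
  have hτ2 : τ = (2 : R) • S := by rw [hτ, two_smul]
  have hτσ : τ.map σ = τ := by rw [hτ, Matrix.map_add (⇑σ) (map_add σ), hSσ]
  have hτs : τᵀ = τ := by rw [hτ, Matrix.transpose_add, hSs]
  have hτu : IsUnit τ.det := by
    rw [hτ2, Matrix.det_smul]
    exact (h2.pow _).mul hSu
  have hform : formCongr σ Cu (Matrix.fromBlocks S 0 0 (-S)) = Matrix.fromBlocks 0 τ τ 0 := formCongr_cayleyMat σ S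
  -- `h = C⁻¹ g C ∈ U(σ, antidiag(τ, τ))`
  have hhU : Cu⁻¹ * g * Cu ∈ unitaryGroupOfForm σ (Matrix.fromBlocks 0 τ τ 0) := by
    rw [← hform, ← conj_mem_unitaryGroupOfForm_iff σ Cu]
    simpa only [mul_assoc, mul_inv_cancel, mul_one, mul_inv_cancel_left] using hgU
  -- the blocks of `h`
  set a := (g : Matrix (ι ⊕ ι) (ι ⊕ ι) R).toBlocks₁₁ with ha
  set b := (g : Matrix (ι ⊕ ι) (ι ⊕ ι) R).toBlocks₁₂ with hb
  set c := (g : Matrix (ι ⊕ ι) (ι ⊕ ι) R).toBlocks₂₁ with hc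
  set d := (g : Matrix (ι ⊕ ι) (ι ⊕ ι) R).toBlocks₂₂ with hd
  have hgabcd : (g : Matrix (ι ⊕ ι) (ι ⊕ ι) R) = Matrix.fromBlocks a b c d := (Matrix.fromBlocks_toBlocks _).symm
  set α : Matrix ι ι R := u • (a + c + (b + d)) with hα
  set β : Matrix ι ι R := u • (a + c - (b + d)) with hβ
  set δ : Matrix ι ι R := u • (a - c - (b - d)) with hδ
  have hhmat : ((Cu⁻¹ * g * Cu : GL (ι ⊕ ι) R) : Matrix (ι ⊕ ι) (ι ⊕ ι) R) = Matrix.fromBlocks α β 0 δ := by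
    change u • C * (g : Matrix (ι ⊕ ι) (ι ⊕ ι) R) * C = _
    rw [Matrix.smul_mul, Matrix.smul_mul, hgabcd, hC, cayleyMat_mul_mul_cayleyMat, Matrix.fromBlocks_smul]
    have hzero : a - c + (b - d) = 0 := by
      rw [show a - c + (b - d) = (a + b) - (c + d) by abel, hgP, sub_self]
    rw [hzero, smul_zero]
  -- `α` is invertible
  have hαu : IsUnit α.det := by
    have hdet : IsUnit ((Cu⁻¹ * g * Cu : GL (ι ⊕ ι) R) : Matrix (ι ⊕ ι) (ι ⊕ ι) R).det :=
      ⟨Matrix.GeneralLinearGroup.det (Cu⁻¹ * g * Cu), rfl⟩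
    rw [hhmat, Matrix.det_fromBlocks_zero₂₁] at hdet
    exact isUnit_of_mul_isUnit_left hdet
  obtain ⟨αU, hαU⟩ := (Matrix.isUnit_iff_isUnit_det α).2 hαu
  -- the Levi homomorphism and the unipotent elements
  obtain ⟨m, hm, hmU⟩ := exists_leviHom σ hσ hτσ hτs hτu
  obtain ⟨nn, hnn, hnn_add, hnnU⟩ := exists_unipotent σ τ
  -- the relation `σ(α)ᵀ τ δ = τ` from `h ∈ U₁`
  have hrel : (α.map σ)ᵀ * τ * δ = τ := by
    have key := hhU
    rw [mem_unitaryGroupOfForm_iff, hhmat, Matrix.fromBlocks_map, Matrix.map_zero σ (map_zero σ),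
      Matrix.fromBlocks_transpose, Matrix.transpose_zero] at key
    simp only [Matrix.fromBlocks_multiply, Matrix.zero_mul, Matrix.mul_zero, add_zero, zero_add] at key
    exact (Matrix.fromBlocks_inj.1 key).2.1
  -- hence `δ = τ⁻¹ σ(α⁻¹)ᵀ τ`
  have hααinv : (α : Matrix ι ι R) * ((αU⁻¹ : GL ι R) : Matrix ι ι R) = 1 := by
    rw [← hαU, ← Units.val_mul, mul_inv_cancel, Units.val_one]
  have hαinvα : ((αU⁻¹ : GL ι R) : Matrix ι ι R) * α = 1 := by
    rw [← hαU, ← Units.val_mul, inv_mul_cancel, Units.val_one]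
  have hδeq : δ = τ⁻¹ * (((αU⁻¹ : GL ι R) : Matrix ι ι R).map σ)ᵀ * τ := by
    have h1 : (((αU⁻¹ : GL ι R) : Matrix ι ι R).map σ)ᵀ * (α.map σ)ᵀ = 1 := by
      rw [← Matrix.transpose_mul, ← Matrix.map_mul, hααinv, Matrix.map_one σ (map_zero σ) (map_one σ),
        Matrix.transpose_one]
    calc δ = τ⁻¹ * ((((αU⁻¹ : GL ι R) : Matrix ι ι R).map σ)ᵀ * (α.map σ)ᵀ) * τ * δ := by
          rw [h1, Matrix.mul_one, Matrix.nonsing_inv_mul τ hτu, Matrix.one_mul]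
      _ = τ⁻¹ * (((αU⁻¹ : GL ι R) : Matrix ι ι R).map σ)ᵀ * ((α.map σ)ᵀ * τ * δ) := by
          simp only [Matrix.mul_assoc]
      _ = τ⁻¹ * (((αU⁻¹ : GL ι R) : Matrix ι ι R).map σ)ᵀ * τ := by rw [hrel]
  -- the factorisation `h = m(α) n(y)`, `y = α⁻¹ β`
  set y : Matrix ι ι R := ((αU⁻¹ : GL ι R) : Matrix ι ι R) * β with hy
  have hfac : Cu⁻¹ * g * Cu = m αU * nn y := by
    refine Units.ext ?_
    rw [hhmat, Units.val_mul, hm, hnn, hαU, Matrix.fromBlocks_multiply]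
    simp only [Matrix.mul_one, Matrix.mul_zero, Matrix.zero_mul, add_zero, zero_add]
    rw [hy, ← Matrix.mul_assoc, hααinv, Matrix.one_mul, ← hδeq]
  have hnyU : nn y ∈ unitaryGroupOfForm σ (Matrix.fromBlocks 0 τ τ 0) := by
    have : nn y = (m αU)⁻¹ * (Cu⁻¹ * g * Cu) := by rw [hfac, inv_mul_cancel_left]
    rw [this]
    exact mul_mem (inv_mem (hmU αU)) hhU
  have hycrit : τ * y + (y.map σ)ᵀ * τ = 0 := (hnnU y).1 hnyU
  -- `z = y/2`: `n(z) ∈ U₁` and `n(z)² = n(y)`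
  set z : Matrix ι ι R := u • y with hz
  have hzσ : z.map σ = u • y.map σ := by
    ext i j
    simp only [hz, Matrix.map_apply, Matrix.smul_apply, smul_eq_mul, map_mul, hσu]
  have hzcrit : τ * z + (z.map σ)ᵀ * τ = 0 := by
    rw [hzσ, Matrix.transpose_smul, Matrix.smul_mul, hz, Matrix.mul_smul, ← smul_add, hycrit, smul_zero]
  have hnzU : nn z ∈ unitaryGroupOfForm σ (Matrix.fromBlocks 0 τ τ 0) := (hnnU z).2 hzcrit
  have hzz : z + z = y := by rw [hz, ← add_smul, ← mul_two, hu, one_smul]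
  have hnnz : nn z * nn z = nn y := by rw [← hnn_add, hzz]
  -- `α = ∏ sᵢ²` in `GL_ι(R)`
  obtain ⟨lα, hlα⟩ := exists_list_sq_of_closure_isSquare_eq_top hGL αU
  -- the list in the Cayley model
  set L : List (GL (ι ⊕ ι) R) := lα.map m ++ [nn z] with hL
  have hLprod : (L.map fun q => q * q).prod = Cu⁻¹ * g * Cu := by
    rw [hL, List.map_append, List.prod_append, map_prod_map_sq m lα, ← hlα, List.map_singleton,
      List.prod_singleton, hnnz, hfac]
  have hLmem : ∀ q ∈ L, q ∈ unitaryGroupOfForm σ (Matrix.fromBlocks 0 τ τ 0) ∧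
      (q : Matrix (ι ⊕ ι) (ι ⊕ ι) R).toBlocks₂₁ = 0 := by
    intro q hq
    rw [hL, List.mem_append, List.mem_map, List.mem_singleton] at hq
    rcases hq with ⟨s, -, rfl⟩ | rfl
    · exact ⟨hmU s, by rw [hm, Matrix.toBlocks_fromBlocks₂₁]⟩
    · exact ⟨hnzU, by rw [hnn, Matrix.toBlocks_fromBlocks₂₁]⟩
  -- conjugate back by `C`
  refine ⟨L.map fun q => Cu * q * Cu⁻¹, fun q' hq' => ?_, ?_⟩
  · rw [List.mem_map] at hq'
    obtain ⟨q, hq, rfl⟩ := hq'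
    obtain ⟨hqU, hq21⟩ := hLmem q hq
    refine ⟨?_, ?_⟩
    · rw [conj_mem_unitaryGroupOfForm_iff σ Cu, hform]
      exact hqU
    · -- the Siegel condition for `C q C⁻¹`
      have hqmat : (q : Matrix (ι ⊕ ι) (ι ⊕ ι) R) =
          Matrix.fromBlocks (q : Matrix (ι ⊕ ι) (ι ⊕ ι) R).toBlocks₁₁ (q : Matrix (ι ⊕ ι) (ι ⊕ ι) R).toBlocks₁₂ 0
            (q : Matrix (ι ⊕ ι) (ι ⊕ ι) R).toBlocks₂₂ := by
        conv_lhs => rw [← Matrix.fromBlocks_toBlocks (q : Matrix (ι ⊕ ι) (ι ⊕ ι) R), hq21]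
      have hconj : ((Cu * q * Cu⁻¹ : GL (ι ⊕ ι) R) : Matrix (ι ⊕ ι) (ι ⊕ ι) R) =
          u • Matrix.fromBlocks
            ((q : Matrix (ι ⊕ ι) (ι ⊕ ι) R).toBlocks₁₁ + 0 +
              ((q : Matrix (ι ⊕ ι) (ι ⊕ ι) R).toBlocks₁₂ + (q : Matrix (ι ⊕ ι) (ι ⊕ ι) R).toBlocks₂₂))
            ((q : Matrix (ι ⊕ ι) (ι ⊕ ι) R).toBlocks₁₁ + 0 -
              ((q : Matrix (ι ⊕ ι) (ι ⊕ ι) R).toBlocks₁₂ + (q : Matrix (ι ⊕ ι) (ι ⊕ ι) R).toBlocks₂₂))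
            ((q : Matrix (ι ⊕ ι) (ι ⊕ ι) R).toBlocks₁₁ - 0 +
              ((q : Matrix (ι ⊕ ι) (ι ⊕ ι) R).toBlocks₁₂ - (q : Matrix (ι ⊕ ι) (ι ⊕ ι) R).toBlocks₂₂))
            ((q : Matrix (ι ⊕ ι) (ι ⊕ ι) R).toBlocks₁₁ - 0 -
              ((q : Matrix (ι ⊕ ι) (ι ⊕ ι) R).toBlocks₁₂ - (q : Matrix (ι ⊕ ι) (ι ⊕ ι) R).toBlocks₂₂)) := by
        change C * (q : Matrix (ι ⊕ ι) (ι ⊕ ι) R) * (u • C) = _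
        rw [Matrix.mul_smul]
        conv_lhs => rw [hqmat, hC, cayleyMat_mul_mul_cayleyMat]
      rw [hconj, Matrix.fromBlocks_smul, Matrix.toBlocks_fromBlocks₁₁, Matrix.toBlocks_fromBlocks₁₂,
        Matrix.toBlocks_fromBlocks₂₁, Matrix.toBlocks_fromBlocks₂₂, ← smul_add, ← smul_add]
      congr 1
      abel
  · -- the product
    have hφ : (L.map fun q => Cu * q * Cu⁻¹) = L.map (MulAut.conj Cu).toMonoidHom := by
      refine List.map_congr_left fun q _ => ?_
      rfl
    rw [hφ, map_prod_map_sq, hLprod]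
    change g = Cu * (Cu⁻¹ * g * Cu) * Cu⁻¹
    rw [← mul_assoc, ← mul_assoc, mul_inv_cancel, one_mul, mul_assoc, mul_inv_cancel, mul_one]


/-! ### packaging: lists in a subgroup -/

/-- repackage a list of elements of `G` lying in a subgroup `U` as a list of elements of `↥U`. [folklore] -/
private theorem exists_list_subtype {G : Type*} [Group G] (U : Subgroup G) (P : G → Prop) :
    ∀ (l : List G) (g : U), (∀ q ∈ l, q ∈ U ∧ P q) → (g : G) = (l.map fun q => q * q).prod →
      ∃ l' : List U, (∀ q ∈ l', P (q : G)) ∧ g = (l'.map fun q => q * q).prod := by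
  intro l
  induction l with
  | nil =>
    intro g _ hg
    refine ⟨[], fun q hq => by simp at hq, Subtype.ext ?_⟩
    simpa using hg
  | cons q l ih =>
    intro g hl hg
    have hq : q ∈ U ∧ P q := hl q (List.mem_cons_self)
    have hl' : ∀ q' ∈ l, q' ∈ U ∧ P q' := fun q' hq' => hl q' (List.mem_cons_of_mem q hq')
    rw [List.map_cons, List.prod_cons] at hg
    have hrest : (l.map fun q => q * q).prod ∈ U := by
      have : (l.map fun q => q * q).prod = (q * q)⁻¹ * (g : G) := by rw [hg, inv_mul_cancel_left]
      rw [this]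
      exact mul_mem (inv_mem (mul_mem hq.1 hq.1)) g.2
    obtain ⟨l', hl'P, hl'eq⟩ := ih ⟨_, hrest⟩ hl' rfl
    refine ⟨⟨q, hq.1⟩ :: l', fun q' hq' => ?_, Subtype.ext ?_⟩
    · rw [List.mem_cons] at hq'
      rcases hq' with rfl | hq'
      · exact hq.2
      · exact hl'P q' hq'
    · rw [List.map_cons, List.prod_cons, Subgroup.coe_mul, ← hl'eq, hg]
      rfl

/-! ### the re-enumerated consumer form -/

omit [CommRing R] [Fintype ι] [DecidableEq ι] in
/-- `reindex e.symm e.symm (reindex e e M) = M`. [folklore] -/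
private theorem reindex_symm_reindex' {m : Type*} (e : ι ⊕ ι ≃ m) (M : Matrix (ι ⊕ ι) (ι ⊕ ι) R) :
    Matrix.reindex e.symm e.symm (Matrix.reindex e e M) = M := by
  simp

/-- **Every element of the Siegel parabolic `P_Δ` of `U(σ, reindex e e (S ⊕ −S))` is a product of squares of elements of
`P_Δ`**, for `σ` an involution of a commutative ring `R` with `2 ∈ Rˣ`, `S` symmetric `σ`-fixed of unit determinant, and
`GL_ι(R)` generated by squares (e.g. `R` a finite product of copies of `ℂ`) — typed on the subgroup, for an arbitrary
spelling `J` of the form and the Siegel condition `DoubledUnitary.IsSiegelReindex e` (GR-2's `IsSiegelDelta`).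
In particular every `{±1}`-valued multiplicative function on `P_Δ` is trivial.  [cite: HarrisKudlaSweet1996, §1 (1.11)] -/
theorem exists_list_sq_of_isSiegelReindex {m : Type*} [Fintype m] [DecidableEq m] (e : ι ⊕ ι ≃ m)
    (hσ : ∀ x, σ (σ x) = x) (h2 : IsUnit (2 : R))
    {S : Matrix ι ι R} (hSσ : S.map σ = S) (hSs : Sᵀ = S) (hSu : IsUnit S.det)
    (hGL : Subgroup.closure {A : GL ι R | IsSquare A} = ⊤)
    (J : Matrix m m R) (hJ : J = Matrix.reindex e e (Matrix.fromBlocks S 0 0 (-S)))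
    (γ : unitaryGroupOfForm σ J) (hγ : IsSiegelReindex e (γ : GL m R)) :
    ∃ l : List (unitaryGroupOfForm σ J),
      (∀ q ∈ l, IsSiegelReindex e ((q : unitaryGroupOfForm σ J) : GL m R)) ∧ γ = (l.map fun q => q * q).prod := by
  subst hJ
  set ψ : GL (ι ⊕ ι) R ≃* GL m R := Units.mapEquiv (Matrix.reindexRingEquiv R e).toMulEquiv with hψ
  have hsub : (Matrix.reindex e e (Matrix.fromBlocks S 0 0 (-S))).submatrix e e = Matrix.fromBlocks S 0 0 (-S) := by
    rw [Matrix.reindex_apply, Matrix.submatrix_submatrix, Equiv.symm_comp_self, Matrix.submatrix_id_id]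
  have hmem : ∀ g : GL (ι ⊕ ι) R, g ∈ unitaryGroupOfForm σ (Matrix.fromBlocks S 0 0 (-S)) ↔
      ψ g ∈ unitaryGroupOfForm σ (Matrix.reindex e e (Matrix.fromBlocks S 0 0 (-S))) := by
    intro g
    have key := reindex_mem_unitaryGroupOfForm_iff σ e (Matrix.reindex e e (Matrix.fromBlocks S 0 0 (-S))) g
    rwa [hsub] at key
  have hcoeψ : ∀ g : GL (ι ⊕ ι) R, ((ψ g : GL m R) : Matrix m m R) = Matrix.reindex e e (g : Matrix (ι ⊕ ι) (ι ⊕ ι) R) :=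
    fun g => rfl
  have hsieg : ∀ g : GL (ι ⊕ ι) R, IsSiegelReindex e (ψ g) ↔
      (g : Matrix (ι ⊕ ι) (ι ⊕ ι) R).toBlocks₁₁ + (g : Matrix (ι ⊕ ι) (ι ⊕ ι) R).toBlocks₁₂ =
        (g : Matrix (ι ⊕ ι) (ι ⊕ ι) R).toBlocks₂₁ + (g : Matrix (ι ⊕ ι) (ι ⊕ ι) R).toBlocks₂₂ := by
    intro g
    unfold IsSiegelReindex
    rw [hcoeψ, reindex_symm_reindex']
  -- pull `γ` back to the block enumeration
  set g : GL (ι ⊕ ι) R := ψ.symm (γ : GL m R) with hg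
  have hψg : ψ g = (γ : GL m R) := ψ.apply_symm_apply _
  have hgU : g ∈ unitaryGroupOfForm σ (Matrix.fromBlocks S 0 0 (-S)) := by rw [hmem, hψg]; exact γ.2
  have hgP := (hsieg g).1 (by rw [hψg]; exact hγ)
  obtain ⟨l, hl, hgl⟩ := exists_list_sq_of_isSiegel_blocks σ hσ h2 hSσ hSs hSu hGL hgU hgP
  -- push the list forward along `ψ`
  have hl' : ∀ q ∈ l.map ψ, q ∈ unitaryGroupOfForm σ (Matrix.reindex e e (Matrix.fromBlocks S 0 0 (-S))) ∧
      IsSiegelReindex e q := by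
    intro q hq
    rw [List.mem_map] at hq
    obtain ⟨q₀, hq₀, rfl⟩ := hq
    exact ⟨(hmem q₀).1 (hl q₀ hq₀).1, (hsieg q₀).2 (hl q₀ hq₀).2⟩
  have hγl : ((γ : unitaryGroupOfForm σ _) : GL m R) = ((l.map ψ).map fun q => q * q).prod := by
    have key := map_prod_map_sq ψ.toMonoidHom l
    rw [MulEquiv.coe_toMonoidHom] at key
    rw [key, ← hgl, hψg]
  exact exists_list_subtype _ (fun q => IsSiegelReindex e q) (l.map ψ) γ hl' hγl

end Literature.NumberTheory.Automorphic.DoubledUnitary
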